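import Mathlib
import Literature.Analysis.FluidPDE.PoincareBall
import Literature.Analysis.FluidPDE.SuitableWeakRescaling
import Literature.Analysis.FluidPDE.SereginSverakPressureProofs
import Literature.Analysis.FluidPDE.BlowupFarField
import Literature.Analysis.FluidPDE.SereginSverak2002VertexBlowupLimit
import Literature.Analysis.FluidPDE.NSSuitableESS
import Literature.Analysis.FluidPDE.ESSLocalHolderHolds
import Literature.Analysis.FluidPDE.ESSLocalHolderBlowupLimit
import Literature.Analysis.FluidPDE.LocalTypeIScaling
import Literature.Analysis.FluidPDE.LocalTypeIPersistenceHolds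
import Literature.Analysis.FluidPDE.LocalTypeICongr
import Literature.Analysis.FluidPDE.LeraySuitableWeakSolutions
import Literature.Analysis.FluidPDE.NSWeakStrongUniquenessHolds
import Literature.Analysis.FluidPDE.TaoLocalisationHolds
import Literature.Analysis.FluidPDE.TaoLocalisationProofs
import Literature.Analysis.FluidPDE.KatoMaximalTimeSingular
import Literature.Analysis.FluidPDE.TypeIRateScaledEnergyBound
import Literature.Analysis.FluidPDE.SereginSverak2002PressureLowerBoundProofs
import Literature.Analysis.FluidPDE.NSLerayHopfABCScaling
import Literature.Analysis.FluidPDE.NSTimeRescaleClassical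
import Literature.Analysis.FluidPDE.NSViscosityRescaling
import Literature.Analysis.FluidPDE.TypeIAncientMildRescale
import Literature.Analysis.FluidPDE.SelfSimilar
import Literature.Analysis.FluidPDE.AncientAxisymmetricTypeILiouville
import Literature.Analysis.FluidPDE.CKNLocalEnergyEstimate
import Literature.Analysis.FluidPDE.CKNPressureEstimate
import Literature.Analysis.FluidPDE.CKNUnforcedOneScaleRRS
import Literature.Analysis.FluidPDE.CKNLocalRegularityRRSPressure
import Literature.Analysis.FluidPDE.RusinSverakSingularityStabilityEpsilon
import Literature.Analysis.FluidPDE.CKNScalingExtras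
import Literature.Analysis.FluidPDE.CKNLocalRegularityRRSStep3
import Literature.Analysis.FluidPDE.PineauVicolOneSliceProofs
import Literature.Analysis.FluidPDE.TsaiLocalEnergyProofs
import Summits.NavierStokesRegularity.NavierStokesRegularity.Theorems.ExtremalTypeIConstantSmallConstantLiouville
import Summits.NavierStokesRegularity.NavierStokesRegularity.Theorems.TypeIQuarterGateScarEnvelopeTypeISatelliteTowerObjects
import Summits.NavierStokesRegularity.NavierStokesRegularity.Theorems.TypeIQuarterGateScarEnvelopeTypeISatelliteTowerEnvelopeLeaves
import Summits.NavierStokesRegularity.NavierStokesRegularity.Theorems.TypeIQuarterGateScarEnvelopeTypeISatelliteTowerRootRateDefs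
import Summits.NavierStokesRegularity.NavierStokesRegularity.Theorems.TypeIQuarterGateScarEnvelopeTypeISatelliteTowerRateLadder
import Summits.NavierStokesRegularity.NavierStokesRegularity.Theorems.TypeIQuarterGateScarEnvelopeTypeISatelliteTowerRateMinimal
import Summits.NavierStokesRegularity.NavierStokesRegularity.Theorems.TypeIQuarterGateScarEnvelopeTypeISatelliteTowerRateFloor

/-!
# Satellite tower for crux `ScarEnvelopeTypeI` (stmt-NavierStokesRegularity-23843) — Part P: THE UNIFORM FLOOR modulo whole-space tangent flows (T∞)

Part P of the ROUND-36 plate (section `UniformFloor`): P0 the absolute constant `epsL = 1/(8·C₀(ℝ³))` and the hypothesis-free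
root-level anchor `ABTower.eq_zero_of_lt_epsL` / `ABTower.regPt_of_lt_epsL` / `singRates_eq_empty_of_lt_epsL` (tree Liouville
`smallConstantLiouville_eq_zero`, KNSS 2009 §4); P1 ★ `rate_of_zooms` (rate inheritance on EVERY `Q_R(0)` for zooms converging in
`L³(Q_R(0))`, unconditional) and `hasTypeITimeDecay_of_rates`; P2 the hypothesis shape (T∞) `GlobalTangentU` / `GlobalTangents M`
(OPEN, never asserted) and the A–B form `SmallRateRegularityAB`; P3 ★ `ABTower.regPt_of_rateAt_of_globalTangents` (under (T∞) a local
Type-I rate `ε < ε_L` at a final-time point of ANY A–B object forces regularity there), `smallRateRegularityAB_of_globalTangents`;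
P4 ★ `ABTower.epsL_le_tightRate`, `ABTower.regPt_or_epsL_le`, `rootRate_trapL`, `epsL_le_minSingRate`, `minSingRate_pos_of_globalTangents`.

PROVENANCE: declaration texts VERBATIM from the HOME plate of the instrument seat nsreg-p3 g26 (cell
`pub/ns-regularity-ideate`): `round-36/Tangent36prep.lean` v10 (sha16 `ce225095590b75bd`; = ROUND-35 plate v9
`ce6f8ea4cb093fca` VERBATIM + 1 tree import + Part P), scored PASS by referee ref3 g26 (`SCORE-p3-ROUND-36-0828.md`); the
author cannot write under `Theorems/` (`perm.theorems-prover-only`); landed by the prover ns-es-p1 g5 as landing hand of record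
(director-ns DIRECTOR-NS #237 (3)) as ONE module, namespace
`Summit.NavierStokesRegularity.NavierStokesRegularity.Cruxes.ScarEnvelopeTypeI.ZoomDictionary` (the plate's `NsregP3.R30P`, as in the
landed dictionary / satellite-tower modules), `E3` spelled out, one-line docstrings added where the plate had none.
`--supports stmt-NavierStokesRegularity-23843 --as helper`.

HONEST FRAMING: a CONDITIONAL ε-regularity / census instrument on hypothetical Type-I zoom limits: every floor statement of
P3–P4 carries the typed, named, UNPROVED hypothesis (T∞) `GlobalTangents M` (whole-space tangent flows in the A–B class —
Albritton–Barker 2019 Prop. 2.2 for zooms + identification; OPEN in the tree, never asserted here); P0–P1 are hypothesis-free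
(the root-level anchor reads the tree's PROVED small-constant Liouville theorem `smallConstantLiouville_eq_zero`).  Scope: the floor
concerns SINGULAR (`¬ RegPt`) final-time points only.  NO open statement is proved — 23843 `TypeIQuarterGate.ScarEnvelopeTypeI`,
(T∞), (L′), (S∞), the route and Navier–Stokes regularity are OPEN.
-/

-- the summit-side namespace repeats a component by design (single-conjunct summit, D-0017)
set_option linter.dupNamespace false

open MeasureTheory Set Metric Filter Topology
open scoped ENNReal NNReal InnerProductSpace
open Literature.Analysis.FluidPDE

namespace Summit.NavierStokesRegularity.NavierStokesRegularity.Cruxes.ScarEnvelopeTypeI.ZoomDictionary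

section UniformFloor

variable {U : ℝ → (EuclideanSpace ℝ (Fin 3)) → (EuclideanSpace ℝ (Fin 3))} {P : ℝ → (EuclideanSpace ℝ (Fin 3)) → ℝ}

open Summit.NavierStokesRegularity.NavierStokesRegularity.Theorems (smallConstantLiouville_eq_zero)

/-! ### P0. The absolute constant and the root-level sanity anchor (no hypothesis) -/

/-- `ε_L = 1/(8·C₀(ℝ³))`, `C₀` the Oseen slice constant of the tree (KNSS 2009 §3 (3.5)). -/
noncomputable def epsL : ℝ := 1 / (8 * oseenSliceConst (EuclideanSpace ℝ (Fin 3)))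

/-- `0 < ε_L`. -/
theorem epsL_pos : 0 < epsL := by
  unfold epsL
  have := oseenSliceConst_pos (E := (EuclideanSpace ℝ (Fin 3)))
  positivity

/-- Root-level anchor (tree Liouville, NO hypothesis): an A–B object whose GLOBAL constant is below
`ε_L` vanishes on the open past, hence is regular at every final-time point. -/
theorem ABTower.eq_zero_of_lt_epsL {M : ℝ} {H : ℝ → (EuclideanSpace ℝ (Fin 3)) → (EuclideanSpace ℝ (Fin 3)) →L[ℝ] (EuclideanSpace ℝ (Fin 3))} (hT : ABTower M U P H)
    (hM : M < epsL) {t : ℝ} (ht : t < 0) (x : (EuclideanSpace ℝ (Fin 3))) : U t x = 0 :=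
  smallConstantLiouville_eq_zero hT.1 hM ht x

/-- A field vanishing for all `t < 0` is regular at every final-time point. -/
theorem regPt_of_eq_zero {U' : ℝ → (EuclideanSpace ℝ (Fin 3)) → (EuclideanSpace ℝ (Fin 3))} (h : ∀ t < 0, ∀ x, U' t x = 0) (y : (EuclideanSpace ℝ (Fin 3))) : RegPt U' y := by
  refine ⟨1, one_pos, 0, ?_⟩
  have hmeas : MeasurableSet (parabolicCylinder 1 (((0 : ℝ), y) : ℝ × (EuclideanSpace ℝ (Fin 3)))) :=
    (isOpen_parabolicCylinder 1 _).measurableSet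
  filter_upwards [ae_restrict_mem hmeas] with z hz
  have hz0 : z.1 < 0 := by simpa using ((mem_parabolicCylinder).1 hz).1.2
  rw [h z.1 hz0 z.2, norm_zero]

/-- Root-level anchor (no hypothesis): an A–B object of a class with `M < ε_L` is regular at every final-time point (tree Liouville `smallConstantLiouville_eq_zero`). -/
theorem ABTower.regPt_of_lt_epsL {M : ℝ} {H : ℝ → (EuclideanSpace ℝ (Fin 3)) → (EuclideanSpace ℝ (Fin 3)) →L[ℝ] (EuclideanSpace ℝ (Fin 3))} (hT : ABTower M U P H)
    (hM : M < epsL) (y : (EuclideanSpace ℝ (Fin 3))) : RegPt U y :=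
  regPt_of_eq_zero (fun _ ht x => hT.eq_zero_of_lt_epsL hM ht x) y

/-! ### P1. Rate inheritance on EVERY parabolic ball `Q_R(0)` -/

/-- **Rate inheritance, global frame.**  `U` continuous on the open past, the local rate
`√(−t)‖U(t,x)‖ ≤ m` on `(−δ², 0) × B(y', δ)`, zooms at `(0, y')` along null scales `L` converging in
`L³(Q_R(0))` to `U'`: then `√(−s)‖U'(s,y)‖ ≤ m` a.e. on `Q_R(0)` — for ANY `R > 0`. -/
theorem rate_of_zooms (hcont : ContinuousOn (Function.uncurry U) (Iio 0 ×ˢ univ)) {y' : (EuclideanSpace ℝ (Fin 3))}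
    {L : ℕ → ℝ} (hLpos : ∀ k, 0 < L k) (hL0 : Tendsto L atTop (𝓝 0)) {U' : ℝ → (EuclideanSpace ℝ (Fin 3)) → (EuclideanSpace ℝ (Fin 3))} {R : ℝ}
    (hR : 0 < R)
    (hU' : AEStronglyMeasurable (Function.uncurry U')
      (volume.restrict (parabolicCylinder R (0 : ℝ × (EuclideanSpace ℝ (Fin 3))))))
    (hconv : Tendsto (fun k => eLpNorm (Function.uncurry (zoom U y' 0 (L k)) - Function.uncurry U') 3
      (volume.restrict (parabolicCylinder R (0 : ℝ × (EuclideanSpace ℝ (Fin 3)))))) atTop (𝓝 0))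
    {m δ : ℝ} (hδ : 0 < δ)
    (hrate : ∀ t ∈ Ioo (-(δ ^ 2)) 0, ∀ x ∈ ball y' δ, Real.sqrt (-t) * ‖U t x‖ ≤ m) :
    ∀ᵐ z ∂(volume.restrict (parabolicCylinder R (0 : ℝ × (EuclideanSpace ℝ (Fin 3))))),
      Real.sqrt (-z.1) * ‖U' z.1 z.2‖ ≤ m := by
  set Q : Set (ℝ × (EuclideanSpace ℝ (Fin 3))) := parabolicCylinder R (0 : ℝ × (EuclideanSpace ℝ (Fin 3))) with hQ
  have hQmeas : MeasurableSet Q := (isOpen_parabolicCylinder R (0 : ℝ × (EuclideanSpace ℝ (Fin 3)))).measurableSet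
  have hmemQ : ∀ z ∈ Q, -(R ^ 2) < z.1 ∧ z.1 < 0 ∧ ‖z.2‖ < R := fun z hz => by
    rw [hQ, mem_parabolicCylinder] at hz
    obtain ⟨⟨h1, h2⟩, h3⟩ := hz
    simp only [Prod.fst_zero, Prod.snd_zero, zero_sub, dist_zero_right] at h1 h2 h3
    exact ⟨h1, h2, h3⟩
  -- ## small scales: `L k · R < δ`
  have hδR : 0 < δ / R := div_pos hδ hR
  obtain ⟨k₀, hk₀⟩ : ∃ k₀ : ℕ, ∀ k ≥ k₀, L k < δ / R :=
    eventually_atTop.1 (hL0.eventually (gt_mem_nhds hδR))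
  -- ## the zooms obey the rate exactly on `Q` once the scale is small
  have hzoomrate : ∀ k ≥ k₀, ∀ z ∈ Q,
      Real.sqrt (-z.1) * ‖zoom U y' 0 (L k) z.1 z.2‖ ≤ m := fun k hk z hz => by
    obtain ⟨hz1, hz2, hz3⟩ := hmemQ z hz
    have hL := hLpos k
    have hLR : L k * R < δ := by
      have := hk₀ k hk
      rwa [lt_div_iff₀ hR] at this
    have hneg : 0 < -z.1 := by linarith
    have ht : (0 : ℝ) + L k ^ 2 * z.1 ∈ Ioo (-(δ ^ 2)) 0 := by
      refine ⟨?_, by nlinarith [mul_pos (pow_pos hL 2) hneg]⟩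
      have h1 : L k ^ 2 * (-z.1) < L k ^ 2 * R ^ 2 :=
        mul_lt_mul_of_pos_left (by linarith) (pow_pos hL 2)
      have h2 : L k ^ 2 * R ^ 2 < δ ^ 2 := by
        have hLR0 : 0 ≤ L k * R := (mul_pos hL hR).le
        calc L k ^ 2 * R ^ 2 = (L k * R) ^ 2 := by ring
          _ < δ ^ 2 := pow_lt_pow_left₀ hLR hLR0 two_ne_zero
      linarith
    have hx : y' + L k • z.2 ∈ ball y' δ := by
      rw [mem_ball, dist_eq_norm, add_sub_cancel_left, norm_smul, Real.norm_of_nonneg hL.le]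
      calc L k * ‖z.2‖ ≤ L k * R := mul_le_mul_of_nonneg_left hz3.le hL.le
        _ < δ := hLR
    have h := hrate _ ht _ hx
    have hsq : Real.sqrt (-((0 : ℝ) + L k ^ 2 * z.1)) = L k * Real.sqrt (-z.1) := by
      rw [show -((0 : ℝ) + L k ^ 2 * z.1) = L k ^ 2 * (-z.1) by ring, Real.sqrt_mul (sq_nonneg _),
        Real.sqrt_sq hL.le]
    rw [hsq] at h
    show Real.sqrt (-z.1) * ‖L k • U (0 + L k ^ 2 * z.1) (y' + L k • z.2)‖ ≤ m
    rw [norm_smul, Real.norm_of_nonneg hL.le]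
    calc Real.sqrt (-z.1) * (L k * ‖U (0 + L k ^ 2 * z.1) (y' + L k • z.2)‖)
        = L k * Real.sqrt (-z.1) * ‖U (0 + L k ^ 2 * z.1) (y' + L k • z.2)‖ := by ring
      _ ≤ m := h
  -- ## measurability of the zooms on `Q` (continuity of `U` on the open past)
  have hmeas : ∀ k, AEStronglyMeasurable (Function.uncurry (zoom U y' 0 (L k)))
      (volume.restrict Q) := fun k => by
    have hL := hLpos k
    have hmap : ContinuousOn (fun z : ℝ × (EuclideanSpace ℝ (Fin 3)) => ((0 : ℝ) + L k ^ 2 * z.1, y' + L k • z.2)) Q :=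
      (by fun_prop : Continuous fun z : ℝ × (EuclideanSpace ℝ (Fin 3)) => ((0 : ℝ) + L k ^ 2 * z.1, y' + L k • z.2)).continuousOn
    have hmaps : MapsTo (fun z : ℝ × (EuclideanSpace ℝ (Fin 3)) => ((0 : ℝ) + L k ^ 2 * z.1, y' + L k • z.2)) Q
        (Iio 0 ×ˢ univ) := by
      intro z hz
      obtain ⟨-, hz2, -⟩ := hmemQ z hz
      have hneg : 0 < -z.1 := by linarith
      exact ⟨by
        show (0 : ℝ) + L k ^ 2 * z.1 < 0
        nlinarith [mul_pos (pow_pos hL 2) hneg], mem_univ _⟩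
    have hcz : ContinuousOn (Function.uncurry (zoom U y' 0 (L k))) Q :=
      ((hcont.comp hmap hmaps).const_smul (L k)).congr fun z _ => rfl
    exact hcz.aestronglyMeasurable hQmeas
  -- ## an a.e.-convergent subsequence of the shifted zooms
  have hconv' : Tendsto (fun k => eLpNorm (Function.uncurry (zoom U y' 0 (L (k + k₀))) -
      Function.uncurry U') 3 (volume.restrict Q)) atTop (𝓝 0) :=
    hconv.comp (tendsto_add_atTop_nat k₀)
  obtain ⟨ns, -, hae⟩ := exists_subseq_tendsto_ae₃ (v := fun k => zoom U y' 0 (L (k + k₀)))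
    (fun k => hmeas (k + k₀)) hU' hconv'
  filter_upwards [hae, ae_restrict_mem hQmeas] with z hz hzQ
  have hlim : Tendsto (fun i => Real.sqrt (-z.1) *
      ‖Function.uncurry (zoom U y' 0 (L (ns i + k₀))) z‖) atTop
      (𝓝 (Real.sqrt (-z.1) * ‖Function.uncurry U' z‖)) :=
    hz.norm.const_mul _
  exact le_of_tendsto' hlim fun i => hzoomrate (ns i + k₀) (Nat.le_add_left _ _) z hzQ

/-- From rates on every `Q_R(0)` to the GLOBAL Type-I time decay. -/
theorem hasTypeITimeDecay_of_rates {U' : ℝ → (EuclideanSpace ℝ (Fin 3)) → (EuclideanSpace ℝ (Fin 3))} {m : ℝ}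
    (h : ∀ R : ℝ, 0 < R → ∀ t ∈ Ioo (-(R ^ 2)) 0, ∀ x ∈ ball (0 : (EuclideanSpace ℝ (Fin 3))) R,
      Real.sqrt (-t) * ‖U' t x‖ ≤ m) :
    HasTypeITimeDecay m U' := by
  intro t ht x
  set R : ℝ := Real.sqrt (-t) + ‖x‖ + 1 with hRdef
  have hs0 : 0 ≤ Real.sqrt (-t) := Real.sqrt_nonneg _
  have hR : 0 < R := by rw [hRdef]; positivity
  have hRt : -(R ^ 2) < t := by
    have h1 : Real.sqrt (-t) < R := by rw [hRdef]; linarith [norm_nonneg x]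
    have h2 : Real.sqrt (-t) ^ 2 < R ^ 2 := pow_lt_pow_left₀ h1 hs0 two_ne_zero
    rw [Real.sq_sqrt (neg_pos.2 ht).le] at h2
    linarith
  have hx : x ∈ ball (0 : (EuclideanSpace ℝ (Fin 3))) R := by
    rw [mem_ball_zero_iff, hRdef]
    linarith [hs0]
  have hst : 0 < Real.sqrt (-t) := Real.sqrt_pos.2 (neg_pos.2 ht)
  have := h R hR t ⟨hRt, ht⟩ x hx
  rw [le_div_iff₀ hst, mul_comm]
  exact this

/-! ### P2. (T∞) WHOLE-SPACE TANGENT FLOWS — hypothesis-shaped, OPEN-in-tree -/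

/-- A **whole-space tangent flow**: the plate's `TangentU` with its four clauses on EVERY `Q_R(0)`,
`R > 0` (not only `R < 1`). -/
def GlobalTangentU (U : ℝ → (EuclideanSpace ℝ (Fin 3)) → (EuclideanSpace ℝ (Fin 3))) (P : ℝ → (EuclideanSpace ℝ (Fin 3)) → ℝ) (y' : (EuclideanSpace ℝ (Fin 3))) (L : ℕ → ℝ)
    (U' : ℝ → (EuclideanSpace ℝ (Fin 3)) → (EuclideanSpace ℝ (Fin 3))) : Prop :=
  (∀ k, 0 < L k) ∧ Tendsto L atTop (𝓝 0) ∧ ∃ pbar : ℝ → (EuclideanSpace ℝ (Fin 3)) → ℝ, ∀ R : ℝ, 0 < R →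
    IsSuitableWeakSolutionInBall R 0 U' pbar ∧
    MemLp (Function.uncurry U') 3 (volume.restrict (parabolicCylinder R (0 : ℝ × (EuclideanSpace ℝ (Fin 3))))) ∧
    Tendsto (fun k => eLpNorm (Function.uncurry (zoom U y' 0 (L k)) - Function.uncurry U') 3
      (volume.restrict (parabolicCylinder R (0 : ℝ × (EuclideanSpace ℝ (Fin 3)))))) atTop (𝓝 0) ∧
    ∀ g : ℝ × (EuclideanSpace ℝ (Fin 3)) → ℝ, MemLp g 3 (volume.restrict (parabolicCylinder R (0 : ℝ × (EuclideanSpace ℝ (Fin 3))))) →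
      Tendsto (fun k => ∫ w in parabolicCylinder R (0 : ℝ × (EuclideanSpace ℝ (Fin 3))), zoomP P y' 0 (L k) w.1 w.2 * g w)
        atTop (𝓝 (∫ w in parabolicCylinder R (0 : ℝ × (EuclideanSpace ℝ (Fin 3))), pbar w.1 w.2 * g w))

/-- A whole-space tangent flow is in particular a tangent flow in the plate's sense (`TangentU`, convergence on `Q_R(0)`, `R < 1`). -/
theorem GlobalTangentU.tangentU {y' : (EuclideanSpace ℝ (Fin 3))} {L : ℕ → ℝ} {U' : ℝ → (EuclideanSpace ℝ (Fin 3)) → (EuclideanSpace ℝ (Fin 3))}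
    (h : GlobalTangentU U P y' L U') : TangentU U P y' 0 L U' := by
  obtain ⟨hL, hL0, pbar, hall⟩ := h
  exact ⟨hL, hL0, pbar, fun R hR => hall R hR.1⟩

/-- **(T∞) `GlobalTangents M`** (Albritton–Barker 2019 Prop. 2.2 for zoom sequences + the tree's
identification of Type-I blow-up limits, hypothesis-shaped): every A–B object has, at every
SINGULAR final-time point, a WHOLE-SPACE tangent flow along some null scale sequence which is again
an A–B object with the same constant `M` (only singular points are ever used). -/
def GlobalTangents (M : ℝ) : Prop :=
  ∀ (U : ℝ → (EuclideanSpace ℝ (Fin 3)) → (EuclideanSpace ℝ (Fin 3))) (P : ℝ → (EuclideanSpace ℝ (Fin 3)) → ℝ) (H : ℝ → (EuclideanSpace ℝ (Fin 3)) → (EuclideanSpace ℝ (Fin 3)) →L[ℝ] (EuclideanSpace ℝ (Fin 3))), ABTower M U P H →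
    ∀ y' : (EuclideanSpace ℝ (Fin 3)), ¬ RegPt U y' →
      ∃ (L : ℕ → ℝ) (U' : ℝ → (EuclideanSpace ℝ (Fin 3)) → (EuclideanSpace ℝ (Fin 3))) (P' : ℝ → (EuclideanSpace ℝ (Fin 3)) → ℝ) (H' : ℝ → (EuclideanSpace ℝ (Fin 3)) → (EuclideanSpace ℝ (Fin 3)) →L[ℝ] (EuclideanSpace ℝ (Fin 3))),
        GlobalTangentU U P y' L U' ∧ ABTower M U' P' H'

/-! ### P3. ★ The UNIFORM small-rate regularity modulo (T∞) -/

/-- Small-rate regularity on the WHOLE A–B class (no `𝐈`-bound): Part N's `SmallRateRegularity`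
restricted to the inputs the census actually feeds it (A–B objects). -/
def SmallRateRegularityAB (M ε : ℝ) : Prop :=
  ∀ (U : ℝ → (EuclideanSpace ℝ (Fin 3)) → (EuclideanSpace ℝ (Fin 3))) (P : ℝ → (EuclideanSpace ℝ (Fin 3)) → ℝ) (H : ℝ → (EuclideanSpace ℝ (Fin 3)) → (EuclideanSpace ℝ (Fin 3)) →L[ℝ] (EuclideanSpace ℝ (Fin 3))), ABTower M U P H →
    ∀ y' : (EuclideanSpace ℝ (Fin 3)), RateAt ε U y' → RegPt U y'

/-- Part N's `SmallRateRegularity M ε` implies its A–B form `SmallRateRegularityAB M ε`. -/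
theorem SmallRateRegularity.toAB {M ε : ℝ} (h : SmallRateRegularity M ε) : SmallRateRegularityAB M ε :=
  fun U P _ hT y' hr => h U P (towerObj_of_abTower hT) y' hr

/-- The A–B form implies Part O's bounded-sub-class form `SmallRateRegularityB M I ε` for every `I`. -/
theorem SmallRateRegularityAB.toB {M ε : ℝ} (h : SmallRateRegularityAB M ε) (I : ℝ) :
    SmallRateRegularityB M I ε :=
  fun U P H hT _ y' hr => h U P H hT y' hr

/-- `SmallRateRegularityAB M ε` is monotone in `ε` (downwards). -/
theorem SmallRateRegularityAB.mono {M ε ε' : ℝ} (h : SmallRateRegularityAB M ε) (hε : ε' ≤ ε) :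
    SmallRateRegularityAB M ε' :=
  fun U P H hT y' hr => h U P H hT y' (hr.mono hε)

/-- **P3a ★★ (UNIFORM FLOOR modulo (T∞)).**  Under `GlobalTangents M`: an A–B object whose velocity
has a local Type-I rate `ε < ε_L = 1/(8·C₀(ℝ³))` near the final-time point `(0, y')` is regular
there — `ε_L` is ABSOLUTE (independent of `M`, `𝐈`, the object).  Route: the rate is inherited by
the whole-space tangent flow on every `Q_R(0)` (P1), becomes its global Type-I constant, the tree's
small-constant Liouville theorem kills the tangent flow, and persistence (L8) is contradicted. -/
theorem ABTower.regPt_of_rateAt_of_globalTangents {M ε : ℝ} (hG : GlobalTangents M)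
    {H : ℝ → (EuclideanSpace ℝ (Fin 3)) → (EuclideanSpace ℝ (Fin 3)) →L[ℝ] (EuclideanSpace ℝ (Fin 3))} (hT : ABTower M U P H) {y' : (EuclideanSpace ℝ (Fin 3))} (hr : RateAt ε U y')
    (hε : ε < epsL) : RegPt U y' := by
  by_contra hy
  obtain ⟨L, U', P', H', hGT, hT'⟩ := hG U P H hT y' hy
  obtain ⟨δ, hδ, hrate⟩ := hr
  have hLpos := hGT.1
  have hL0 := hGT.2.1
  obtain ⟨pbar, hRall⟩ := hGT.2.2
  have hcU : ContinuousOn (Function.uncurry U) (Iio 0 ×ˢ univ) := hT.1.1.continuousOn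
  have hcU' : ContinuousOn (Function.uncurry U') (Iio 0 ×ˢ univ) := hT'.1.1.continuousOn
  -- the rate of `U'`, a.e. on every `Q_R(0)`, then everywhere, then as a global Type-I decay
  have hae : ∀ R : ℝ, 0 < R → ∀ᵐ z ∂(volume.restrict (parabolicCylinder R (0 : ℝ × (EuclideanSpace ℝ (Fin 3))))),
      Real.sqrt (-z.1) * ‖U' z.1 z.2‖ ≤ ε := fun R hR => by
    have hmeasU' : AEStronglyMeasurable (Function.uncurry U')
        (volume.restrict (parabolicCylinder R (0 : ℝ × (EuclideanSpace ℝ (Fin 3))))) :=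
      (hcU'.mono (parabolicCylinder_subset_lowerHalf R (0 : (EuclideanSpace ℝ (Fin 3))))).aestronglyMeasurable
        (isOpen_parabolicCylinder R _).measurableSet
    exact rate_of_zooms hcU hLpos hL0 hR hmeasU' (hRall R hR).2.2.1 hδ hrate
  have hall : ∀ R : ℝ, 0 < R → ∀ t ∈ Ioo (-(R ^ 2)) 0, ∀ x ∈ ball (0 : (EuclideanSpace ℝ (Fin 3))) R,
      Real.sqrt (-t) * ‖U' t x‖ ≤ ε := fun R hR => rate_everywhere_of_ae hcU' (hae R hR)
  have hdec : HasTypeITimeDecay ε U' := hasTypeITimeDecay_of_rates hall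
  have hmild : IsTypeIAncientMild ε U' := ⟨hT'.1.1, hT'.1.2.1, hT'.1.2.2.1, hdec⟩
  -- Liouville: the tangent flow vanishes, hence is regular at the origin
  have hzero : ∀ t < 0, ∀ x, U' t x = 0 := fun t ht x => smallConstantLiouville_eq_zero hmild hε ht x
  have hreg : RegPt U' 0 := regPt_of_eq_zero hzero 0
  -- persistence of the singularity down the tangent flow (L8): contradiction
  exact (towerObj_of_abTower hT).not_regPt_tangentU_zero hy hGT.tangentU hreg

/-- **P3b ★ (Part N's hypothesis from (T∞), with the absolute constant).** -/
theorem smallRateRegularityAB_of_globalTangents {M ε : ℝ} (hG : GlobalTangents M) (hε : ε < epsL) :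
    SmallRateRegularityAB M ε :=
  fun _ _ _ hT _ hr => hT.regPt_of_rateAt_of_globalTangents hG hr hε

/-! ### P4. Consequences: the uniform floor of the rate ladder, the trap, the minimal singular rate -/

/-- Under `SmallRateRegularityAB M ε`, every SINGULAR final-time point of an A–B object has tight rate `≥ ε`. -/
theorem ABTower.le_tightRate_of_not_regPt_AB {M ε : ℝ} (hS : SmallRateRegularityAB M ε)
    {H : ℝ → (EuclideanSpace ℝ (Fin 3)) → (EuclideanSpace ℝ (Fin 3)) →L[ℝ] (EuclideanSpace ℝ (Fin 3))} (hT : ABTower M U P H) {y' : (EuclideanSpace ℝ (Fin 3))} (hy : ¬ RegPt U y') :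
    ε ≤ tightRate U y' := by
  by_contra hlt
  exact hy (hS U P H hT y' ((towerObj_of_abTower hT).rateAt_of_tightRate_lt (lt_of_not_ge hlt)))

/-- **P4a ★ (THE UNIFORM FLOOR OF THE RATE LADDER modulo (T∞)).**  At a singular final-time point of
ANY A–B object: `tightRate ≥ ε_L`. -/
theorem ABTower.epsL_le_tightRate {M : ℝ} (hG : GlobalTangents M) {H : ℝ → (EuclideanSpace ℝ (Fin 3)) → (EuclideanSpace ℝ (Fin 3)) →L[ℝ] (EuclideanSpace ℝ (Fin 3))}
    (hT : ABTower M U P H) {y' : (EuclideanSpace ℝ (Fin 3))} (hy : ¬ RegPt U y') : epsL ≤ tightRate U y' := by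
  by_contra hlt
  have hlt' : tightRate U y' < epsL := lt_of_not_ge hlt
  set ε : ℝ := (tightRate U y' + epsL) / 2 with hεdef
  have h1 : tightRate U y' < ε := by rw [hεdef]; linarith
  have h2 : ε < epsL := by rw [hεdef]; linarith
  exact hy (hT.regPt_of_rateAt_of_globalTangents hG
    ((towerObj_of_abTower hT).rateAt_of_tightRate_lt h1) h2)

/-- The singular/regular dichotomy with the absolute gap. -/
theorem ABTower.regPt_or_epsL_le {M : ℝ} (hG : GlobalTangents M) {H : ℝ → (EuclideanSpace ℝ (Fin 3)) → (EuclideanSpace ℝ (Fin 3)) →L[ℝ] (EuclideanSpace ℝ (Fin 3))}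
    (hT : ABTower M U P H) (y' : (EuclideanSpace ℝ (Fin 3))) : RegPt U y' ∨ epsL ≤ tightRate U y' := by
  by_cases hy : RegPt U y'
  · exact Or.inl hy
  · exact Or.inr (hT.epsL_le_tightRate hG hy)

/-- **P4b ★ (THE TRAP with the absolute floor, modulo (T∞)).**  Part N's `rootRate_trap` with the
Wang–Zhang hypothesis REPLACED by (T∞): along an infinite root descent the tight root rates decrease
to a limit `m_∞ ∈ [ε_L, M]`. -/
theorem rootRate_trapL {M : ℝ} (hG : GlobalTangents M) {c : ℕ → TNode}
    (hc : ∀ k, RootObj M (c k) ∧ ¬ TameRoot (c k) ∧ RootDescends (c k) (c (k + 1))) :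
    ∃ m : ℝ, m ∈ Icc epsL M ∧ Antitone (fun k => tightRate (c k).U 0) ∧
      (∀ k, tightRate (c k).U 0 ∈ Icc m M) ∧
      Tendsto (fun k => tightRate (c k).U 0) atTop (𝓝 m) := by
  obtain ⟨m, hm, hle, ht⟩ := rootRate_tendsto hc
  have hε : ∀ k, epsL ≤ tightRate (c k).U 0 := fun k =>
    (hc k).1.1.epsL_le_tightRate hG (hc k).1.2
  exact ⟨m, ⟨ge_of_tendsto' ht hε, hm.2⟩, rootRate_antitone hc,
    fun k => ⟨hle k, (rootRate_mem_Icc hc k).2⟩, ht⟩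

/-- **P4c ★ (THE MINIMAL SINGULAR RATE IS AT LEAST `ε_L`, modulo (T∞)).**  Uniform in `M`. -/
theorem epsL_le_minSingRate {M : ℝ} (hG : GlobalTangents M) (hne : (singRates M).Nonempty) :
    epsL ≤ minSingRate M :=
  le_csInf hne fun _ ⟨_, _, _, _, hAB, hy, hr⟩ => hr ▸ hAB.epsL_le_tightRate hG hy

/-- Under (T∞) the class-wide minimal singular rate is positive (when some scar exists). -/
theorem minSingRate_pos_of_globalTangents {M : ℝ} (hG : GlobalTangents M)
    (hne : (singRates M).Nonempty) : 0 < minSingRate M :=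
  epsL_pos.trans_le (epsL_le_minSingRate hG hne)

/-- **P4d (no small class has a scar, modulo (T∞)).**  If `M < ε_L` the class has no singular rate at
all — consistent with the root-level anchor P0 (which needs no hypothesis). -/
theorem singRates_eq_empty_of_lt_epsL {M : ℝ} (hM : M < epsL) : singRates M = ∅ := by
  ext r
  simp only [Set.mem_empty_iff_false, iff_false]
  rintro ⟨U, P, H, y, hAB, hy, -⟩
  exact hy (hAB.regPt_of_lt_epsL hM y)

end UniformFloor

end Summit.NavierStokesRegularity.NavierStokesRegularity.Cruxes.ScarEnvelopeTypeI.ZoomDictionary
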